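import Summits.BirchSwinnertonDyer.Rank1Residual.GaloisImage.IrreducibleModThreeH3Tower
import HarnessLib

/-!
# No non-zero `Γ_ℚ`-fixed point in `E[3^{k+1}]` when `E[3]` is irreducible — the binder `h0` of the
# injectivity dévissage / END-m2 files, discharged
# (cell `b2b-bsdres`, team n1011; seat p09 GEN 7, review-duty by-product for rows T-INJ-DEV (p15),
# T-INJ-DEV-K (p11), T-E2-REC (p18); ROUTE-1 §33.3 / §35.2)

HONEST FRAMING (cell `b2b-bsdres`, run/shared/lean/b2b/bsd-rank1-residual/, verbatim in every
file): the goal of the cell is to DELETE the COMBINATION-SHAPED residual classes of the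
Birch–Swinnerton-Dyer formula for ALL analytic-rank `≤ 1` elliptic curves over `ℚ` — "full BSD
formula for every rank `≤ 1` curve in class `C`" assembled STRICTLY from published theorems — so
that the rank-`≤ 1` remainder becomes exactly the CONSTRUCTION-SHAPED classes, which are TYPED
(missing-input `Prop`s), NOT attempted. This is not "finishing BSD". Team n1011: research route on
the CONSTRUCTION-SHAPED class X4 (§I N11); no claim beyond the stated classes; nothing booked; no
mark / label moved. TOOL theorems only: no definition, no named fact, no `sorry`.

## What and why

n1011-p15's dévissage END `KSDevissage.apply_eq_zero_of_apply_eq_zero_levelTwo`, its END-m2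
`exists_ne_zero_mem_selmerGroup_three_of_dictionaryTwo_of_levelTwo_certificate`, and n1011-p11's
all-depth injectivity `KolyvaginInjectivityAllDepths` carry the hypothesis
`h0 : ∀ P : E[3^{j+1}], (∀ σ, σ • P = P) → P = 0` (no non-zero rational — indeed no `Γ_ℚ`-fixed —
`3`-power torsion point; it makes `incl_* : H¹(ℚ, E[3]) → H¹(ℚ, E[3^{j+1}])` injective).  On every
N11 row `ρ̄_{E,3}` is onto, in particular `E[3]` is irreducible, and then `h0` holds at EVERY depth:
cc-typer-1's `exists_smul_eq_neg_three_pow_mul_of_irr` gives `z ∈ Γ_ℚ` acting as `−1` on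
`E[3^{k+1}]`, so a fixed `P` has `2P = 0`, and `3^{k+1} P = 0` with `3^{k+1}` odd forces `P = 0`.

* `forall_torsion_three_fixed_eq_zero_of_irr` / `…_of_surj` — depth `0` (`E[3]`, the spelling
  `geomTorsion W ((3 : ℕ) : ℤ)` of the `h0` binders);
* `forall_torsion_three_pow_mul_fixed_eq_zero_of_irr` / `…_of_surj` — every depth `k`
  (`geomTorsion W (((3 : ℕ) : ℤ) ^ k * ((3 : ℕ) : ℤ))`, the spelling of p11's `h0` at depth `j`).

References: [Serre1972] §2.4 Prop. 15; [MazurRubin2004] Lemma 3.5.2; r1 `cells/n1011/ROUTE-1.md` §35.2.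
-/

noncomputable section

open scoped Classical NumberField ContRepresentation
open Field NumberField IsDedekindDomain WeierstrassCurve
open Literature.NumberTheory.EllipticCurves Literature.NumberTheory.EllipticCurves.Rank1Residual
  Literature.NumberTheory.GaloisRepresentations

namespace Summit.BirchSwinnertonDyer.Rank1Residual.GaloisImage

variable (W : WeierstrassCurve ℚ) [W.IsElliptic]

/-- **`E[3^{k+1}]^{Γ_ℚ} = 0` when `E[3]` is irreducible** (every depth `k`; spelling
`E[3^k · 3]`): an element `z ∈ Γ_ℚ` acting as `−1` on `E[3^{k+1}]` exists
(`exists_smul_eq_neg_three_pow_mul_of_irr`), so a `Γ_ℚ`-fixed `P` satisfies `2 • P = 0`; with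
`3^{k+1} • P = 0` and `3^{k+1} = 2j + 1` this gives `P = 0`.  Discharges the binder `h0` of
n1011-p11's `KolyvaginInjectivityAllDepths` at depth `j = k`. [cite: Serre1972, §2.4 Prop. 15]
[cite: MazurRubin2004, Lemma 3.5.2] -/
theorem forall_torsion_three_pow_mul_fixed_eq_zero_of_irr (hirr : Irr W 3) (k : ℕ) :
    ∀ P : geomTorsion W (((3 : ℕ) : ℤ) ^ k * ((3 : ℕ) : ℤ)),
      (∀ σ : absoluteGaloisGroup ℚ,
        W.torsionGaloisModule (((3 : ℕ) : ℤ) ^ k * ((3 : ℕ) : ℤ)) σ P = P) → P = 0 := by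
  haveI : Fact (Nat.Prime 3) := ⟨Nat.prime_three⟩
  obtain ⟨z, hz⟩ := exists_smul_eq_neg_three_pow_mul_of_irr W hirr k
  intro P hP
  have h := hP z
  rw [torsionGaloisModule_apply_apply, hz] at h
  -- `2 • P = 0`
  have h2 : (2 : ℕ) • P = 0 := by
    rw [two_nsmul]
    nth_rewrite 1 [← h]
    exact neg_add_cancel P
  -- `3^{k+1} • P = 0` with `3^{k+1}` odd
  have h3 := pow_succ_nsmul_geomTorsion_eq_zero W 3 k P
  obtain ⟨j, hj⟩ : Odd (3 ^ (k + 1)) := Odd.pow (by decide)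
  rw [hj, add_nsmul, one_nsmul, mul_nsmul, h2, nsmul_zero, zero_add] at h3
  exact h3

/-- **`E[3]^{Γ_ℚ} = 0` when `E[3]` is irreducible** (depth `0`, spelling `geomTorsion W 3` — the
binder `h0` of n1011-p15's `KSDevissage.apply_eq_zero_of_apply_eq_zero_levelTwo` and END-m2
`exists_ne_zero_mem_selmerGroup_three_of_dictionaryTwo_of_levelTwo_certificate`): `z` acting as `−1`
on `E[3]` (`exists_smul_eq_neg_three_of_irr`), `2 • P = 0`, `3 • P = 0`, hence `P = 0`.
[cite: Serre1972, §2.4 Prop. 15] [cite: MazurRubin2004, Lemma 3.5.2] -/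
theorem forall_torsion_three_fixed_eq_zero_of_irr (hirr : Irr W 3) :
    ∀ P : geomTorsion W ((3 : ℕ) : ℤ),
      (∀ σ : absoluteGaloisGroup ℚ, W.torsionGaloisModule ((3 : ℕ) : ℤ) σ P = P) → P = 0 := by
  haveI : Fact (Nat.Prime 3) := ⟨Nat.prime_three⟩
  obtain ⟨z, hz⟩ := exists_smul_eq_neg_three_of_irr W hirr
  intro P hP
  have h := hP z
  rw [torsionGaloisModule_apply_apply, hz] at h
  have h2 : (2 : ℕ) • P = 0 := by
    rw [two_nsmul]
    nth_rewrite 1 [← h]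
    exact neg_add_cancel P
  have h3 : (2 + 1 : ℕ) • P = 0 := (AddSubgroup.torsionBy.nsmul P : (3 : ℕ) • P = 0)
  rw [add_nsmul, one_nsmul, h2, zero_add] at h3
  exact h3

/-- **`E[3^{k+1}]^{Γ_ℚ} = 0` when `ρ̄_{E,3}` is onto** (every N11 row; every depth `k`).
[cite: Serre1972, §2.4 Prop. 15] -/
theorem forall_torsion_three_pow_mul_fixed_eq_zero_of_surj
    (h3 : W.HasSurjectiveModNGaloisRep ((3 : ℕ) : ℤ)) (k : ℕ) :
    ∀ P : geomTorsion W (((3 : ℕ) : ℤ) ^ k * ((3 : ℕ) : ℤ)),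
      (∀ σ : absoluteGaloisGroup ℚ,
        W.torsionGaloisModule (((3 : ℕ) : ℤ) ^ k * ((3 : ℕ) : ℤ)) σ P = P) → P = 0 :=
  haveI : Fact (Nat.Prime 3) := ⟨Nat.prime_three⟩
  forall_torsion_three_pow_mul_fixed_eq_zero_of_irr W
    (hasIrreducibleModPGaloisRep_of_hasSurjectiveModNGaloisRep W 3 h3) k

/-- **`E[3]^{Γ_ℚ} = 0` when `ρ̄_{E,3}` is onto** (every N11 row; the `h0` of END-m2 discharged from
its own binder `h3`). [cite: Serre1972, §2.4 Prop. 15] -/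
theorem forall_torsion_three_fixed_eq_zero_of_surj (h3 : W.HasSurjectiveModNGaloisRep ((3 : ℕ) : ℤ)) :
    ∀ P : geomTorsion W ((3 : ℕ) : ℤ),
      (∀ σ : absoluteGaloisGroup ℚ, W.torsionGaloisModule ((3 : ℕ) : ℤ) σ P = P) → P = 0 :=
  haveI : Fact (Nat.Prime 3) := ⟨Nat.prime_three⟩
  forall_torsion_three_fixed_eq_zero_of_irr W (hasIrreducibleModPGaloisRep_of_hasSurjectiveModNGaloisRep W 3 h3)

end Summit.BirchSwinnertonDyer.Rank1Residual.GaloisImage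

end
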